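import Summits.CriticalPhenomena.Ising3DConformalLimit.Theses.CanonicalBranchRefutation
import Summits.CriticalPhenomena.Ising3DConformalLimit.Theorems.CanonicalBranchRefutationCanonicalDimensionIsWickPlanarSymmHarmonic
import Summits.CriticalPhenomena.Ising3DConformalLimit.Theorems.CanonicalBranchRefutationCanonicalDimensionIsWickKelvinHarmonicAt
import Summits.CriticalPhenomena.Ising3DConformalLimit.Theorems.CanonicalBranchRefutationCanonicalDimensionIsWickSphereTransport
import Summits.CriticalPhenomena.Ising3DConformalLimit.Theorems.CanonicalBranchRefutationCanonicalDimensionIsWickHarmonicPairSandwichIsWick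
import HarnessLib

/-!
# Crux `CanonicalDimensionIsWick` (stmt-CriticalPhenomena-15520) of route `CanonicalBranchRefutation`:
# PROVED — Wick rigidity at the canonical dimension `Δ = ½`

THEOREM-ONLY file (no definitions).  The crux: every correlation family `S` on `ℝ³` that is a
pointwise scaling limit of some lattice family, reflection positive along the three axes
(pointwise Osterwalder–Schrader matrices over non-coincident half-space configurations), obeys the
GKS-II / Lebowitz sandwich `S₂S₂ ≤ S₄ ≤ ΣS₂S₂` on non-coincident quadruples, is non-degenerate and
Möbius covariant with `Δ = 1/2`, has `U₄ ≡ 0` on non-coincident quadruples.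

This file is the kernel-checked COMPOSITION of the four landed stubs of line `registered` (the
planner's birth skeleton, reshaped by the lead to the slot-SYMMETRISED slice
`T_Y(z) = S 4 (Fin.cons z Y) + S 4 (Fin.snoc Y z)` — without permutation symmetry the OS blocks
(1,3)/(3,1) control only `T_Y`):

* `stub_planarSymmHarmonic` (file `…PlanarSymmHarmonic`): `T_Y` is harmonic below an axis mirror
  when `Y` is above it (discrete OS null vector of the harmonic one-point kernel `A‖p − θp′‖⁻¹` at
  `Δ = ½`, discriminant Cauchy–Schwarz for NON-symmetric reflection-positive matrices, double
  stencil `o(h⁴)`, Weyl's lemma);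
* `stub_kelvinHarmonicAt` (file `…KelvinHarmonicAt`): the Kelvin transform preserves harmonicity
  in `ℝ³`;
* `stub_sphereTransport` (file `…SphereTransport`): a small sphere round `z₀ ∌ Y` through the centre
  of a unit inversion becomes an axis plane, and inversion covariance at `Δ = ½` is the Kelvin
  weight, so `T_Y` is harmonic on all of `(range Y)ᶜ`;
* `stub_harmonicPairSandwichIsWick` (file `…HarmonicPairSandwichIsWick`, = support item
  `HarmonicPairSandwichIsWick` verbatim): a harmonic function sandwiched between the Coulomb tails
  and their sum is the sum (removable singularities + Liouville);

and the glue `CanonicalDimensionIsWick_of`: poles `X`, weights from the two-point law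
`S₂ = A‖·‖⁻¹` (`exists_amplitude`), `F = T_X/2`; GKS-II in BOTH orderings = the three lower bounds,
Lebowitz in BOTH orderings = the upper bound, the sandwich ⇒ `T_X(x₀) = 2·Wick`, Lebowitz per
ordering ⇒ `S₄(x₀, X) = Wick`, i.e. `U₄(x) = 0`.  `CanonicalDimensionIsWick_of_stubs` is the
crux BY NAME.

References: Glimm–Jaffe, *Quantum Physics* (1987) §6.1 [GlimmJaffe1987]; Pohlmeyer, CMP 12 (1969)
[Pohlmeyer1969]; Axler–Bourdon–Ramey, *Harmonic Function Theory* (2001) Thms 2.3, 4.7;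
Lebowitz, CMP 35 (1974) [Lebowitz1974]; Friedli–Velenik (2017) Thm 3.20 [FriedliVelenik2017].
-/

noncomputable section

namespace Summit.CriticalPhenomena.Ising3DConformalLimit.Cruxes.CanonicalDimensionIsWick.Birth

open Literature.Probability.LatticeModels
open Literature.MathematicalPhysics.QuantumFieldTheory (IsReflectionPositiveAlong)
open Summit.CriticalPhenomena.Ising3DConformalLimit.Theses.CanonicalBranchRefutation
open Filter Set Function EuclideanGeometry InnerProductSpace
open scoped Topology BigOperators

/-! ## Glue lemmas (sorry-free) -/

/-- Packaged two-point law with its positive amplitude: under non-degeneracy and Möbius covariance at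
`Δ = 1/2` there is `A > 0` with `S₂(a,b) = A · ‖a - b‖⁻¹` for all `a ≠ b`. [folklore] -/
theorem exists_amplitude {S : CorrFamily 3} (hnd : IsNondegenerateTwoPoint S)
    (hM : IsMoebiusCovariant (1 / 2 : ℝ) S) :
    ∃ A : ℝ, 0 < A ∧ ∀ a b : EuclideanSpace ℝ (Fin 3), a ≠ b → S 2 ![a, b] = A * ‖a - b‖⁻¹ := by
  set e : EuclideanSpace ℝ (Fin 3) := EuclideanSpace.single 0 1 with he
  have hne : ‖e‖ = 1 := by simp [he]
  have he0 : (0 : EuclideanSpace ℝ (Fin 3)) ≠ e := by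
    intro h
    rw [← h, norm_zero] at hne
    exact zero_ne_one hne
  have hpair : Function.Injective ![(0 : EuclideanSpace ℝ (Fin 3)), e] := by
    intro i j hij
    fin_cases i <;> fin_cases j <;> simp_all
  refine ⟨S 2 ![0, e], hnd _ ((mem_nonCoincident _).2 hpair), ?_⟩
  intro a b hab
  rw [two_point_law hM.isEuclideanInvariant hM.isScaleCovariant hab, mul_comm]

/-! ## The composition: stubs ⇒ crux (sorry-free) -/

/-- **ASSEMBLY of line `registered`** (the registered skeleton's composition, verbatim): the crux BY
NAME from the statements of STUB A (planar symmetrised harmonicity), STUB B (Kelvin), STUB C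
(sphere transport) and the support item `HarmonicPairSandwichIsWick` BY NAME (= STUB D verbatim).
Poles `X = (x₁,x₂,x₃)`, weights from the two-point law, `F = T_X/2` with
`T_X(z) = S₄(z, X) + S₄(X, z)`; GKS-II (both orderings) = the three lower bounds, Lebowitz (both
orderings) = the upper bound, the sandwich ⇒ `T_X(x₀) = 2·Wick`, Lebowitz per ordering ⇒
`S₄(x₀, X) = Wick`, i.e. `U₄(x) = 0`. [folklore] -/
theorem CanonicalDimensionIsWick_of
    (hA : ∀ S : CorrFamily 3,
      (∃ (G : LatticeCorrFamily 3) (ρ : ℝ → ℝ), HasPointwiseScalingLimit G ρ S) →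
      (∀ τ : Fin 3, IsReflectionPositiveAlong τ S) →
      IsNondegenerateTwoPoint S → IsMoebiusCovariant (1 / 2 : ℝ) S →
      ∀ (τ : Fin 3) (Y : Fin 3 → EuclideanSpace ℝ (Fin 3)), Function.Injective Y →
        (∀ j, 0 < Y j τ) →
        InnerProductSpace.HarmonicOnNhd
          (fun z => S 4 (Fin.cons z Y) + S 4 (Fin.snoc Y z)) {z | z τ < 0})
    (hB : ∀ (v : EuclideanSpace ℝ (Fin 3) → ℝ) (c z : EuclideanSpace ℝ (Fin 3)), z ≠ c →
      InnerProductSpace.HarmonicAt v (EuclideanGeometry.inversion c 1 z) →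
      InnerProductSpace.HarmonicAt
        (fun y => ‖y - c‖⁻¹ * v (EuclideanGeometry.inversion c 1 y)) z)
    (hC : ∀ S : CorrFamily 3, IsMoebiusCovariant (1 / 2 : ℝ) S →
      (∀ (τ : Fin 3) (Y : Fin 3 → EuclideanSpace ℝ (Fin 3)), Function.Injective Y →
        (∀ j, 0 < Y j τ) →
        InnerProductSpace.HarmonicOnNhd
          (fun z => S 4 (Fin.cons z Y) + S 4 (Fin.snoc Y z)) {z | z τ < 0}) →
      (∀ (v : EuclideanSpace ℝ (Fin 3) → ℝ) (c z : EuclideanSpace ℝ (Fin 3)), z ≠ c →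
        InnerProductSpace.HarmonicAt v (EuclideanGeometry.inversion c 1 z) →
        InnerProductSpace.HarmonicAt
          (fun y => ‖y - c‖⁻¹ * v (EuclideanGeometry.inversion c 1 y)) z) →
      ∀ Y : Fin 3 → EuclideanSpace ℝ (Fin 3), Function.Injective Y →
        InnerProductSpace.HarmonicOnNhd
          (fun z => S 4 (Fin.cons z Y) + S 4 (Fin.snoc Y z)) (Set.range Y)ᶜ)
    (hW : HarmonicPairSandwichIsWick) :
    CanonicalDimensionIsWick := by
  intro S hlim hos hgks hleb hnd hM x hx
  -- split the quadruple `x = (y₀, X)` into its head and the triple of poles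
  obtain ⟨y₀, X, rfl⟩ : ∃ (y₀ : EuclideanSpace ℝ (Fin 3)) (X : Fin 3 → EuclideanSpace ℝ (Fin 3)),
      x = Fin.cons y₀ X := ⟨x 0, Fin.tail x, (Fin.cons_self_tail x).symm⟩
  have hxinj : Function.Injective (Fin.cons y₀ X : Fin 4 → EuclideanSpace ℝ (Fin 3)) :=
    (mem_nonCoincident _).1 hx
  have hXinj : Function.Injective X := (Fin.cons_injective_iff.1 hxinj).2
  have hy₀ : y₀ ∉ Set.range X := (Fin.cons_injective_iff.1 hxinj).1
  -- evaluation of the cons- and snoc-tuples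
  have ev0 : ∀ y : EuclideanSpace ℝ (Fin 3), (Fin.cons y X : Fin 4 → EuclideanSpace ℝ (Fin 3)) 0 = y :=
    fun y => rfl
  have ev1 : ∀ y : EuclideanSpace ℝ (Fin 3), (Fin.cons y X : Fin 4 → EuclideanSpace ℝ (Fin 3)) 1 = X 0 :=
    fun y => rfl
  have ev2 : ∀ y : EuclideanSpace ℝ (Fin 3), (Fin.cons y X : Fin 4 → EuclideanSpace ℝ (Fin 3)) 2 = X 1 :=
    fun y => rfl
  have ev3 : ∀ y : EuclideanSpace ℝ (Fin 3), (Fin.cons y X : Fin 4 → EuclideanSpace ℝ (Fin 3)) 3 = X 2 :=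
    fun y => rfl
  have sv0 : ∀ y : EuclideanSpace ℝ (Fin 3), (Fin.snoc X y : Fin 4 → EuclideanSpace ℝ (Fin 3)) 0 = X 0 :=
    fun y => rfl
  have sv1 : ∀ y : EuclideanSpace ℝ (Fin 3), (Fin.snoc X y : Fin 4 → EuclideanSpace ℝ (Fin 3)) 1 = X 1 :=
    fun y => rfl
  have sv2 : ∀ y : EuclideanSpace ℝ (Fin 3), (Fin.snoc X y : Fin 4 → EuclideanSpace ℝ (Fin 3)) 2 = X 2 :=
    fun y => rfl
  have sv3 : ∀ y : EuclideanSpace ℝ (Fin 3), (Fin.snoc X y : Fin 4 → EuclideanSpace ℝ (Fin 3)) 3 = y :=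
    fun y => rfl
  -- the two-point law and its amplitude
  obtain ⟨A, hA0, htp⟩ := exists_amplitude hnd hM
  -- poles are distinct, so the pair correlations among them are positive
  have hXne : ∀ {i j : Fin 3}, i ≠ j → X i ≠ X j := fun hij h => hij (hXinj h)
  have hpair : ∀ {a b : EuclideanSpace ℝ (Fin 3)}, a ≠ b → Function.Injective ![a, b] := by
    intro a b h i j hij
    fin_cases i <;> fin_cases j <;> simp_all [h.symm]
  have hS2 : ∀ {i j : Fin 3}, i ≠ j → 0 ≤ S 2 ![X i, X j] := fun hij =>
    (hnd _ ((mem_nonCoincident _).2 (hpair (hXne hij)))).le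
  -- symmetry of the two-point function off the diagonal
  have hsym : ∀ a b : EuclideanSpace ℝ (Fin 3), a ≠ b → S 2 ![a, b] = S 2 ![b, a] := by
    intro a b hab
    rw [htp a b hab, htp b a (Ne.symm hab), norm_sub_rev]
  -- the weights
  obtain ⟨w, hw0, hw1, hw2⟩ : ∃ w : Fin 3 → ℝ, w 0 = A * S 2 ![X 1, X 2] ∧
      w 1 = A * S 2 ![X 0, X 2] ∧ w 2 = A * S 2 ![X 0, X 1] :=
    ⟨![A * S 2 ![X 1, X 2], A * S 2 ![X 0, X 2], A * S 2 ![X 0, X 1]], rfl, rfl, rfl⟩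
  have hw : ∀ j, 0 ≤ w j := by
    intro j
    fin_cases j
    · simpa [hw0] using mul_nonneg hA0.le (hS2 (show (1 : Fin 3) ≠ 2 by decide))
    · simpa [hw1] using mul_nonneg hA0.le (hS2 (show (0 : Fin 3) ≠ 2 by decide))
    · simpa [hw2] using mul_nonneg hA0.le (hS2 (show (0 : Fin 3) ≠ 1 by decide))
  -- off the poles, `(y, X)` and `(X, y)` are non-coincident quadruples
  have hmem : ∀ y ∉ Set.range X,
      (Fin.cons y X : Fin 4 → EuclideanSpace ℝ (Fin 3)) ∈ NonCoincident 3 4 := fun y hy =>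
    (mem_nonCoincident _).2 (Fin.cons_injective_iff.2 ⟨hy, hXinj⟩)
  have hmem' : ∀ y ∉ Set.range X,
      (Fin.snoc X y : Fin 4 → EuclideanSpace ℝ (Fin 3)) ∈ NonCoincident 3 4 := fun y hy =>
    (mem_nonCoincident _).2 (Fin.snoc_injective_iff.2 ⟨hXinj, hy⟩)
  -- the Wick sums at `(y, X)` and at `(X, y)` are both `∑ j, w j / ‖y - X j‖`
  have hwick : ∀ y ∉ Set.range X,
      S 2 ![y, X 0] * S 2 ![X 1, X 2] + S 2 ![y, X 1] * S 2 ![X 0, X 2] +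
        S 2 ![y, X 2] * S 2 ![X 0, X 1] = ∑ j, w j * ‖y - X j‖⁻¹ := by
    intro y hy
    have hy' : ∀ j, y ≠ X j := fun j h => hy ⟨j, h.symm⟩
    rw [htp y (X 0) (hy' 0), htp y (X 1) (hy' 1), htp y (X 2) (hy' 2), Fin.sum_univ_three,
      hw0, hw1, hw2]
    ring
  have hwick' : ∀ y ∉ Set.range X,
      S 2 ![X 0, X 1] * S 2 ![X 2, y] + S 2 ![X 0, X 2] * S 2 ![X 1, y] +
        S 2 ![X 0, y] * S 2 ![X 1, X 2] = ∑ j, w j * ‖y - X j‖⁻¹ := by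
    intro y hy
    have hy' : ∀ j, y ≠ X j := fun j h => hy ⟨j, h.symm⟩
    rw [← hsym y (X 0) (hy' 0), ← hsym y (X 1) (hy' 1), ← hsym y (X 2) (hy' 2), ← hwick y hy]
    ring
  -- the symmetrised slice `T` and `F = T / 2`
  obtain ⟨T, hT⟩ : ∃ T : EuclideanSpace ℝ (Fin 3) → ℝ,
      ∀ z, T z = S 4 (Fin.cons z X) + S 4 (Fin.snoc X z) := ⟨_, fun _ => rfl⟩
  have hTfun : (fun z => S 4 (Fin.cons z X) + S 4 (Fin.snoc X z)) = T := funext fun z => (hT z).symm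
  have hTharm : InnerProductSpace.HarmonicOnNhd T (Set.range X)ᶜ := by
    rw [← hTfun]
    exact hC S hM (hA S hlim hos hnd hM) hB X hXinj
  obtain ⟨F, hF⟩ : ∃ F : EuclideanSpace ℝ (Fin 3) → ℝ, ∀ z, F z = 2⁻¹ * T z := ⟨_, fun _ => rfl⟩
  have hFfun : F = (2⁻¹ : ℝ) • T := funext fun z => by rw [hF, Pi.smul_apply, smul_eq_mul]
  have hFharm : InnerProductSpace.HarmonicOnNhd F (Set.range X)ᶜ := by
    rw [hFfun]
    exact hTharm.const_smul
  -- GKS-II in both orderings: the three lower bounds for `T`, hence for `F`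
  have hlow : ∀ y ∉ Set.range X, ∀ j, w j * ‖y - X j‖⁻¹ ≤ F y := by
    intro y hy j
    have hy' : ∀ j, y ≠ X j := fun j h => hy ⟨j, h.symm⟩
    obtain ⟨h1, h2, h3⟩ := hgks _ (hmem y hy)
    obtain ⟨g1, g2, g3⟩ := hgks _ (hmem' y hy)
    rw [ev0, ev1, ev2, ev3] at h1 h2 h3
    rw [sv0, sv1, sv2, sv3] at g1 g2 g3
    fin_cases j
    · have e1 : w 0 * ‖y - X 0‖⁻¹ = S 2 ![y, X 0] * S 2 ![X 1, X 2] := by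
        rw [htp y (X 0) (hy' 0), hw0]; ring
      have e2 : S 2 ![X 0, y] * S 2 ![X 1, X 2] = S 2 ![y, X 0] * S 2 ![X 1, X 2] := by
        rw [hsym (X 0) y (Ne.symm (hy' 0))]
      show w 0 * ‖y - X 0‖⁻¹ ≤ F y
      rw [hF, hT]
      linarith
    · have e1 : w 1 * ‖y - X 1‖⁻¹ = S 2 ![y, X 1] * S 2 ![X 0, X 2] := by
        rw [htp y (X 1) (hy' 1), hw1]; ring
      have e2 : S 2 ![X 0, X 2] * S 2 ![X 1, y] = S 2 ![y, X 1] * S 2 ![X 0, X 2] := by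
        rw [hsym (X 1) y (Ne.symm (hy' 1))]; ring
      show w 1 * ‖y - X 1‖⁻¹ ≤ F y
      rw [hF, hT]
      linarith
    · have e1 : w 2 * ‖y - X 2‖⁻¹ = S 2 ![y, X 2] * S 2 ![X 0, X 1] := by
        rw [htp y (X 2) (hy' 2), hw2]; ring
      have e2 : S 2 ![X 0, X 1] * S 2 ![X 2, y] = S 2 ![y, X 2] * S 2 ![X 0, X 1] := by
        rw [hsym (X 2) y (Ne.symm (hy' 2))]; ring
      show w 2 * ‖y - X 2‖⁻¹ ≤ F y
      rw [hF, hT]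
      linarith
  -- Lebowitz in both orderings: the upper bound
  have hupc : ∀ y ∉ Set.range X, S 4 (Fin.cons y X) ≤ ∑ j, w j * ‖y - X j‖⁻¹ := by
    intro y hy
    have h := hleb _ (hmem y hy)
    unfold limitConnectedFour at h
    rw [ev0, ev1, ev2, ev3] at h
    rw [← hwick y hy]
    linarith
  have hups : ∀ y ∉ Set.range X, S 4 (Fin.snoc X y) ≤ ∑ j, w j * ‖y - X j‖⁻¹ := by
    intro y hy
    have h := hleb _ (hmem' y hy)
    unfold limitConnectedFour at h
    rw [sv0, sv1, sv2, sv3] at h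
    rw [← hwick' y hy]
    linarith
  have hup : ∀ y ∉ Set.range X, F y ≤ ∑ j, w j * ‖y - X j‖⁻¹ := by
    intro y hy
    rw [hF, hT]
    linarith [hupc y hy, hups y hy]
  -- the sandwich (support item / STUB D) at `y = y₀`
  have key := hW X w F hXinj hw hFharm hlow hup y₀ hy₀
  rw [hF, hT] at key
  have h4 : S 4 (Fin.cons y₀ X) = ∑ j, w j * ‖y₀ - X j‖⁻¹ := by
    linarith [hupc y₀ hy₀, hups y₀ hy₀]
  rw [← hwick y₀ hy₀] at h4
  show limitConnectedFour S (Fin.cons y₀ X) = 0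
  unfold limitConnectedFour
  rw [ev0, ev1, ev2, ev3]
  linarith

/-- **The crux `CanonicalDimensionIsWick`, PROVED**: the composition `CanonicalDimensionIsWick_of`
fed the four LANDED stubs of line `registered` by name (STUB D's signature is definitionally the
support item `HarmonicPairSandwichIsWick`). -/
theorem CanonicalDimensionIsWick_of_stubs : CanonicalDimensionIsWick :=
  CanonicalDimensionIsWick_of stub_planarSymmHarmonic stub_kelvinHarmonicAt stub_sphereTransport
    stub_harmonicPairSandwichIsWick

end Summit.CriticalPhenomena.Ising3DConformalLimit.Cruxes.CanonicalDimensionIsWick.Birth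

end
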